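import Summits.QuantumFields.QCD.Theses.PauliWegnerSea
import Summits.QuantumFields.QCD.Theorems.TiltedFlatness.Negative.TwoWellFloor
import Summits.QuantumFields.QCD.Theorems.TiltedFlatness.Negative.MasslessKernel
import Literature.MathematicalPhysics.QuantumFieldTheory.StrongCouplingActivities
import Literature.MathematicalPhysics.QuantumFieldTheory.QCDPhaseQuenched
import Literature.Analysis.Approximation.CarberyWrightProofs
import Literature.Analysis.Approximation.MarkovInequality
import HarnessLib.Audit
import Summits.QuantumFields.QCD.Theorems.PauliWegnerSeaTiltedFlatnessStubActionLipschitz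
import Summits.QuantumFields.QCD.Theorems.PauliWegnerSeaTiltedFlatnessStubEulerWord
import Summits.QuantumFields.QCD.Theorems.PauliWegnerSeaTiltedFlatnessStubCircleEngine
import Summits.QuantumFields.QCD.Theorems.PauliWegnerSeaTiltedFlatnessStubTorusSmallBalls
import Summits.QuantumFields.QCD.Theorems.PauliWegnerSeaTiltedFlatnessStubBandLimit
import Summits.QuantumFields.QCD.Theorems.PauliWegnerSeaTiltedFlatnessStubCircleUntilt
import Summits.QuantumFields.QCD.Theorems.PauliWegnerSeaTiltedFlatnessStubHaarSmallBalls

/-!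
# Line `circle-transport` — skeleton for crux `PauliWegnerSea.TiltedFlatness` (LEAD'S RESHAPE r2)

RESHAPED by the lead `prover-line-stmt-QuantumFields-14070-0` (2026-08-16): (1) every stub is stated
CIRCLE-GENERICALLY and DEF-FREE — for an arbitrary family `T : ℝ → SU(3)` with the matrix form
`diag(e^{iθ}, e^{-iθ}, 1)` (verbatim the hypothesis of the route's `PauliBandLimit`), trigonometric
polynomials spelled out as `∃ a : ℤ → ℂ, ∀ t, ↑(f t) = Σ_{|k|≤D} a k e^{ikt}` — so that every stub helper file
lands kernel-reviewed (no `def`); the skeleton instantiates `T := diagCircle`; (2) the FGZ telescope is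
replaced by the flat-torus route: `stub_torusSmallBalls` (slice induction on `[-π,π]^m` from the 1-D engine +
Nikolskii, pure Lebesgue) and `stub_haarSmallBalls` (word coupling `Haar = Haar ∗ Φ_*Leb` + ontoness ⇒
`FibreSmallBalls`, the lead's stub); (3) the 1-D engine stub carries Nikolskii's inequality as a second
conjunct; (4) the two concrete one-link stubs are asked only for `4 ≤ L` (all the glue uses).
Seven registered stubs: `stub_bandLimit`, `stub_actionLipschitz`, `stub_eulerWord`, `stub_circleEngine`,
`stub_torusSmallBalls`, `stub_haarSmallBalls` (lead), `stub_circleUntilt`.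

## Original planner text (r1)
(item stmt-QuantumFields-14070, route route-QuantumFields-PauliWegnerSea rank 3; crux-plan round 1,
planner-cruxplan-stmt-QuantumFields-14070-circle-transport-0; idea card
`Cruxes/TiltedFlatness/Ideas/circle-transport.md`, triage TRIAGE-r1-{1,2,3}: pass ×3)

The crux `C′` (text = the disprover's `TiltedFlatnessRepaired`, `Disproof.lean: repaired_iff_current := Iff.rfl`):
for every `N_f` there are `C, p, c > 0` such that on every two-star fibre (links of `star(x) ∪ star(y)` free,
outside frozen to `U`), with `F = ‖det diracMatrix‖`, `wt = e^{-β·wilsonAction}`, product Haar, `Z = ∫ wt`,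
`M = ∫ F wt / Z`: (a) `F(W₀) ≤ C(1+β)^p M` for all `W₀`; (b′) `M > 0 → ∫ 1{F ≤ εM} wt / Z ≤ C(1+β)^p ε^c`.

## The line (one lever, five engines, one proved trunk)

LEVER (card): left-translate ONE star link along a conjugated diagonal circle `s ↦ A·T(s)·B`,
`T(s) = diag(e^{is}, e^{-is}, 1)` (`diagCircle`, a concrete one-parameter family in `SU(3)`,
`coe_diagCircle` = the hypothesis of the route's `PauliBandLimit` verbatim).  This single move is
(I) exactly product-Haar preserving (`MeasureTheory.Measure.pi.isMulLeftInvariant`, element `Pi.mulSingle e g`),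
(P) degree preserving — `s ↦ F²` is a trigonometric polynomial of degree `≤ 8 N_f` (rank `2+2` of the hop
projectors `(1 ∓ γ_μ)/2`, two-sided, every `L ≥ 1`, every mass: `stub_bandLimit`), and
(L) `K|s|`-cheap against the Wilson tilt (`K = 12 = 2 × 6` plaquettes: `stub_actionLipschitz`).
Iterated along a SURJECTIVE word of conjugated circles per link (`SU(3) = SU(2)₁₂·SU(2)₂₃·SU(2)₁₂`, `ZYZ` inside
blocks: `stub_eulerWord`), every fibre of the word sees the GLOBAL sup of `F` and the GLOBAL min of the action,
and both clauses become one-variable facts about non-negative trigonometric polynomials (`stub_circleSmallBall`,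
an elementary consequence of the in-tree `CarberyWright.remez_weak` after `u = tan(s/2)`).

Following the panel (r1-1/2/3 "sharpen": with the kernel-checked trunk
`tiltedFlatness_of_R1_density : HaarRelativeSmallBalls → TiltDensityBound → TiltedFlatness` of
`Lines/R1DensityReduction.lean`, the arc-transport proof of clause (a) is optional; make the card's §5 ball-free
untilt THE shared density stub and the FGZ telescope the (R1) stub), the skeleton is:

* `stub_circleTelescope : EulerWord → CircleSmallBall → FibreSmallBalls` — the Fefferman–Ghosh–Zhan telescope
  (arXiv:2407.19561 Thm 4.1 / §4.1) along circle subgroups, stated ABSTRACTLY on `SU(3)^E` for any continuous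
  `F ≥ 0` depending on `≤ n` listed coordinates whose square is band-limited of degree `≤ D` along every circle
  at those coordinates: `Haar{F ≤ ε F(W₀)} ≤ C(D,n) ε^{c(D,n)}` (`c = 1/(9nD)`-type).  LOAD-BEARING / hardest.
* `stub_circleUntilt : EulerWord → FibreDensity` — card §5: for any continuous `S` depending on `≤ n` listed
  coordinates and `K`-Lipschitz along every circle there, `e^{-βS}/∫e^{-βS} dHaar ≤ C (1+β)^p` (`p = 9n·#word`),
  by full-circle averaging (invariance + Fubini) and "the word fibre through ANY `W` contains a global minimiser";
  NO Haar-ball volume on `SU(3)`, no Weyl formula (the `Barriers/UnitaryHaarSmallBall` detour is not needed).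
* `stub_bandLimit`, `stub_actionLipschitz`, `stub_eulerWord`, `stub_circleSmallBall` — the four engines.
* GLUE (sorry-free, this file): the `≤ 16` star edges are LISTED (`starEdge`, `starEdge_cover`, `star_starEdge`),
  `refit ∘ update = update ∘ refit` on star edges, whence `FibreSmallBalls ⇒ HaarRelativeSmallBalls` and
  `FibreDensity ⇒ TiltDensityBound` for the crux's own `F`, `wt`; then the trunk (INLINED VERBATIM from
  `Lines/R1DensityReduction.lean`, ideator 3 / triage ×3 re-checked: that module is not yet built on the farm, so it
  cannot be imported today — same namespace discipline as `GluonicCompletion/Lines/fibre-flatness-conditional-package`).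
* `cruxOfCircleTransport_holds : CruxOfCircleTransport` where `CruxOfCircleTransport := BandLimit → ActionLipschitz →
  EulerWord → CircleSmallBall → CircleTelescope → CircleUntilt → PauliWegnerSea.TiltedFlatness` (the kernel-checked
  composition over the six stub STATEMENTS, axioms {propext, Classical.choice, Quot.sound}), and
  `TiltedFlatness_of : PauliWegnerSea.TiltedFlatness` — the ONLY theorem of the file whose type is literally the route
  decl — = that composition applied to the six sorried `stub_*` (so the A12 audit has exactly one candidate).

Constants (card §7, for orientation only — every stub is `∃ C …`): `D = 8N_f`, `K = 12`, `m = 9·16 = 144` circles;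
(R1) `c = 2c₁/m` with `c₁ = 1/(2D)`; density `p₀ = m`; the trunk then gives `p = max(p₀/c, p₀)`.  Honours
`Disproof.lean`: target = route decl BY NAME; `p > 0` in (a) (`not_tiltedFlatnessNoLossA`) and `(1+β)^{p₀}` in (b′)
(`twinWell_refutes_smallBallClause`, `Negative/TwoWellFloor`) are forced by the trunk's shape; constants depend on
`N_f` through `D` (`not_tiltedFlatnessUniformInNf`); `F ≡ 0` fibres (`Negative/MasslessKernel`,
`kerWilsonDiracMassless_holds`) only ever enter through the guards `0 < F W₀` / `0 < M`.

Recorded alternative (card's namesake, NOT a stub): `ArcTransport` (§7 below) + arc-Remez gives clause (a) directly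
with `p = 2Dm`, never locating a minimiser; kept for the lead should the trunk route stall.
-/

namespace Summit.QuantumFields.QCD.Cruxes.TiltedFlatness.CircleTransport

open scoped BigOperators Real Matrix.Norms.L2Operator
open MeasureTheory Set Filter
open Literature.MathematicalPhysics.QuantumFieldTheory Literature.MathematicalPhysics.QuantumLattice
  Literature.Probability.LatticeModels
open Summit.QuantumFields.QCD.Theses.PauliWegnerSea

/-- `SU(3)` (the tree's `Matrix.specialUnitaryGroup (Fin 3) ℂ`). -/
local notation "SU3" => Matrix.specialUnitaryGroup (Fin 3) ℂ

/-! ## §0 Vocabulary: the diagonal circle and trigonometric polynomials -/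

/-- The matrix `diag(e^{iθ}, e^{-iθ}, 1)`. -/
noncomputable def diagCircleMatrix (θ : ℝ) : Matrix (Fin 3) (Fin 3) ℂ :=
  Matrix.diagonal ![Complex.exp (θ * Complex.I), Complex.exp (-(θ * Complex.I)), 1]

theorem exp_mul_I_mul_star (x : ℝ) :
    Complex.exp (x * Complex.I) * star (Complex.exp (x * Complex.I)) = 1 := by
  rw [Complex.star_def, Complex.mul_conj, Complex.normSq_eq_norm_sq, Complex.norm_exp_ofReal_mul_I]
  simp

theorem exp_neg_mul_I_eq (x : ℝ) :
    Complex.exp (-(x * Complex.I)) = Complex.exp ((-x : ℝ) * Complex.I) := by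
  push_cast; ring_nf

/-- `diag(e^{iθ}, e^{-iθ}, 1) ∈ SU(3)`. -/
theorem diagCircleMatrix_mem (θ : ℝ) : diagCircleMatrix θ ∈ Matrix.specialUnitaryGroup (Fin 3) ℂ := by
  rw [Matrix.mem_specialUnitaryGroup_iff, Matrix.mem_unitaryGroup_iff]
  constructor
  · rw [diagCircleMatrix, Matrix.star_eq_conjTranspose, Matrix.diagonal_conjTranspose,
      Matrix.diagonal_mul_diagonal, ← Matrix.diagonal_one]
    congr 1
    funext i
    fin_cases i
    · simpa using exp_mul_I_mul_star θ
    · simpa [exp_neg_mul_I_eq] using exp_mul_I_mul_star (-θ)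
    · simp
  · rw [diagCircleMatrix, Matrix.det_diagonal, Fin.prod_univ_three]
    simp [← Complex.exp_add]

/-- THE CIRCLE `T(θ) = diag(e^{iθ}, e^{-iθ}, 1)` as a one-parameter family in `SU(3)` (closed subgroup,
period `2π`; its conjugates `A·T(·)·A⁻¹` are all circle subgroups with spectrum `{e^{iθ}, e^{-iθ}, 1}`). -/
noncomputable def diagCircle (θ : ℝ) : SU3 := ⟨diagCircleMatrix θ, diagCircleMatrix_mem θ⟩

/-- `diagCircle` satisfies the hypothesis of the route's `PauliBandLimit` (stmt-11514) verbatim. -/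
@[simp] theorem coe_diagCircle (θ : ℝ) :
    ((diagCircle θ : SU3) : Matrix (Fin 3) (Fin 3) ℂ) =
      Matrix.diagonal ![Complex.exp (θ * Complex.I), Complex.exp (-(θ * Complex.I)), 1] := rfl


/-- MATRIX FORM of a diagonal circle family `T : ℝ → SU(3)`: `T(θ) = diag(e^{iθ}, e^{-iθ}, 1)` — verbatim the
hypothesis of the route's support item `PauliBandLimit` (stmt-11514).  Every stub below is stated for an
arbitrary `T` with this property (there is exactly one, `diagCircle`), so that stub helper files need no `def`. -/
def IsDiagCircle (T : ℝ → SU3) : Prop :=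
  ∀ θ : ℝ, ((T θ : SU3) : Matrix (Fin 3) (Fin 3) ℂ) =
    Matrix.diagonal ![Complex.exp (θ * Complex.I), Complex.exp (-(θ * Complex.I)), 1]

/-- `diagCircle` has the matrix form. -/
theorem isDiagCircle_diagCircle : IsDiagCircle diagCircle := fun θ => coe_diagCircle θ

/-! ## §1 The stub statements (currency), circle-generic in `T`

Each is a transparent `def … : Prop` HERE (a Cruxes file); the registered `stub_*` theorems of §4 and the
workers' helper files state them EXPANDED (no `def` crosses into `Theorems/`). -/

/-- (P) TWO-SIDED BAND LIMIT of the sea along the circle at ONE link (`L ≥ 4`): for every flavour number,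
masses, configuration `U`, edge `e` and `A, B ∈ SU(3)`, `s ↦ ‖det diracMatrix(U[e ↦ A·T(s)·B]) mq‖²` is a
trigonometric polynomial of degree `≤ 48 N_f` (the lead asks only for a CRUDE `L`-free degree: per flavour the
coefficient matrices of `e^{±is}` in `D_W` have at most `24` non-zero ROWS each (`12` forward rows at the site `e.1`,
`12` backward rows at `shift e.1 e.2`; only `4 + 4` after gauging `A, B` away), so `det D_W = Σ_{|k|≤24} c_k e^{iks}` by
row-multilinearity / the Leibniz degree count on the row-rescaled polynomial matrix — NO rank computation of the
chiral projectors `(1 ∓ γ_μ)/2` is needed (that would give Pauli's sharp `4`); `det diracMatrix = Π_f det D_W(m_f)` (`det_diracMatrix`) is real (`det_diracMatrix_im`), so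
`‖det‖² = det · conj det` has degree `≤ 8 N_f`.  Cheaper road for the two-sidedness: gauge-transform at the site
`shift e.1 e.2` by `B` (`fermionDet_wilsonDirac_gaugeTransform`, needs `e.1 ≠ shift e.1 e.2`, true for `L ≥ 2`)
to reduce to the one-sided `U_e · T(s)` form of `PauliBandLimit`.) -/
def BandLimit (T : ℝ → SU3) : Prop :=
  ∀ (Nf : ℕ) (mq : Fin Nf → ℝ) (L : ℕ) [NeZero L], 4 ≤ L → ∀ (U : GaugeConfig 4 L SU3) (e : Edge 4 L) (A B : SU3),
    ∃ a : ℤ → ℂ, ∀ s : ℝ,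
      ((‖(diracMatrix (Function.update U e (A * T s * B)) mq).det‖ ^ 2 : ℝ) : ℂ) =
        ∑ k ∈ Finset.Icc (-((48 * Nf : ℕ) : ℤ)) ((48 * Nf : ℕ) : ℤ), a k * Complex.exp ((k : ℂ) * (s : ℂ) * Complex.I)

/-- (L) LIPSCHITZ OF THE WILSON ACTION ALONG THE CIRCLE AT ONE LINK (`L ≥ 4`), uniformly in `L`, the
configuration, the edge and the conjugators: `|S(U[e ↦ A T(s) B]) − S(U[e ↦ A T(s′) B])| ≤ K |s − s′|`
(the link lies in `≤ 6` plaquettes — `≤ 12` index pairs of `wilsonAction`'s sum can mention it — and each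
term `3 − Re tr(X·A T(s) B·Y)` moves at rate `≤ |Q₁₁| + |Q₂₂| ≤ 2`, `Q = B Y X A` unitary; all other terms
cancel; only `∃ K` is claimed). -/
def ActionLipschitz (T : ℝ → SU3) : Prop :=
  ∃ K : ℝ, 0 ≤ K ∧ ∀ (L : ℕ) [NeZero L], 4 ≤ L → ∀ (U : GaugeConfig 4 L SU3) (e : Edge 4 L) (A B : SU3) (s s' : ℝ),
    |wilsonAction (fundamentalRep (Fin 3)) (Function.update U e (A * T s * B)) -
        wilsonAction (fundamentalRep (Fin 3)) (Function.update U e (A * T s' * B))| ≤ K * |s - s'|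

/-- (E) SURJECTIVE WORD OF CONJUGATED CIRCLES: finitely many FIXED `V_j ∈ SU(3)` such that every `g ∈ SU(3)` is
the ordered product `Π_j V_j T(s_j) V_j⁻¹` (`d = 9`: `SU(3) = SU(2)₁₂·SU(2)₂₃·SU(2)₁₂` — choose the right
`SU(2)₁₂` factor to kill the entry `g₃₁`, then the left one to make `e₁` fixed, leaving an `SU(2)₂₃` block;
`ZYZ` Euler angles inside a block, the `Z`-circle being `T` itself resp. its conjugate by the cyclic permutation
matrix (det `+1`), the `Y`-circle being `V₀ T V₀⁻¹` for the quarter turn `V₀ = exp(-iπσ₁/4)` — eigenvectors of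
`R_y` do not depend on the angle). -/
def EulerWord (T : ℝ → SU3) : Prop :=
  ∃ (d : ℕ) (V : Fin d → SU3), ∀ g : SU3, ∃ s : Fin d → ℝ,
    g = (List.ofFn fun j => V j * T (s j) * (V j)⁻¹).prod

/-- (N) NIKOLSKII'S INEQUALITY for NON-NEGATIVE trigonometric polynomials of degree `≤ D`:
`f(t) ≤ (2D+1) ⨍_{[-π,π]} f` (`a_k = ⨍ f e^{-ik·}`, `|a_k| ≤ ⨍ |f| = ⨍ f = a₀`, `f ≤ Σ|a_k|`). -/
def Nikolskii : Prop :=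
  ∀ (D : ℕ) (f : ℝ → ℝ),
    (∃ a : ℤ → ℂ, ∀ t : ℝ, ((f t : ℝ) : ℂ) =
      ∑ k ∈ Finset.Icc (-(D : ℤ)) D, a k * Complex.exp ((k : ℂ) * (t : ℂ) * Complex.I)) →
    (∀ t, 0 ≤ f t) → ∀ t : ℝ, f t ≤ (2 * D + 1) * ((∫ s in Set.Icc (-π) π, f s) / (2 * π))

/-- (SB) ONE-VARIABLE ENGINE: mean-relative small balls on the circle for NON-NEGATIVE trigonometric
polynomials of degree `≤ D` with positive mean: `|{t ∈ [−π,π] : f(t) ≤ ε·⨍f}| ≤ C ε^c` (`c = 1/(2D)`;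
half-angle chart `u = tan(t/2)` on three arcs of length `4π/3`, `f·(1+u²)^D = R(u)` with `deg R ≤ 2D`, and the
sublevel form of `Literature.Analysis.Approximation.CarberyWright.remez_weak` (PROVED); or Cartan's lemma
`Literature.Analysis.Complex.CartanLemma.exists_radius_prod_ge` on `P(z) = z^D Σ a_k z^k`; `D = 0`: `f`
constant, `C ≥ 2π`, `c = 1`). -/
def CircleSmallBall : Prop :=
  ∀ D : ℕ, ∃ C c : ℝ, 0 < C ∧ 0 < c ∧ ∀ f : ℝ → ℝ,
    (∃ a : ℤ → ℂ, ∀ t : ℝ, ((f t : ℝ) : ℂ) =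
      ∑ k ∈ Finset.Icc (-(D : ℤ)) D, a k * Complex.exp ((k : ℂ) * (t : ℂ) * Complex.I)) →
    (∀ t, 0 ≤ f t) → 0 < ∫ t in Set.Icc (-π) π, f t → ∀ ε : ℝ, 0 < ε →
      volume {t ∈ Set.Icc (-π) π | f t ≤ ε * ((∫ s in Set.Icc (-π) π, f s) / (2 * π))} ≤
        ENNReal.ofReal (C * ε ^ c)

/-- (TSB) SMALL BALLS ON THE FLAT TORUS for continuous `q ≥ 0` on `ℝ^m` that are trigonometric polynomials of
degree `≤ D` in EACH variable separately (all others frozen), relative to ANY reference value `q(θ₀) > 0`: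
`Leb{θ ∈ [-π,π]^m : q θ ≤ η q θ₀} ≤ C η^c`, `C, c` depending on `(m, D)` only.  (Slice induction on `m`:
freeze the last angle at `θ₀`'s value to get `R` in the same class with `R(θ₀') = q(θ₀)`; on a slice `θ'`,
Nikolskii gives `⨍_t q(t,θ') ≥ R(θ')/(2D+1)`, so if `R(θ') ≥ √η R(θ₀')` the 1-D engine bounds the slice by
`C₁((2D+1)√η)^{c₁}`, and `{R < √η R(θ₀')}` is the induction hypothesis; Tonelli via
`MeasureTheory.volume_preserving_piFinSuccAbove`.) -/
def TorusSmallBalls : Prop :=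
  ∀ (m D : ℕ), ∃ C c : ℝ, 0 < C ∧ 0 < c ∧ ∀ q : (Fin m → ℝ) → ℝ, Continuous q → (∀ θ, 0 ≤ q θ) →
    (∀ (θ : Fin m → ℝ) (j : Fin m), ∃ a : ℤ → ℂ, ∀ t : ℝ, ((q (Function.update θ j t) : ℝ) : ℂ) =
      ∑ k ∈ Finset.Icc (-(D : ℤ)) D, a k * Complex.exp ((k : ℂ) * (t : ℂ) * Complex.I)) →
    ∀ θ₀ : Fin m → ℝ, 0 < q θ₀ → ∀ η : ℝ, 0 < η →
      (volume {θ ∈ Set.Icc (fun _ : Fin m => -π) (fun _ => π) | q θ ≤ η * q θ₀}).toReal ≤ C * η ^ c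

/-- (R1-abstract) HAAR RELATIVE SMALL BALLS ON `SU(3)^E` FOR BAND-LIMITED AMPLITUDES.  For every degree `D`
and every `n` there are `C, c > 0` such that: for every finite index type `E`, every list `r : ι → E` of at
most `n` coordinates, and every continuous `F ≥ 0` on `E → SU(3)` that depends only on the listed coordinates
and whose SQUARE is a trigonometric polynomial of degree `≤ D` along every two-sided circle
`s ↦ W[r i ↦ A T(s) B]`, one has `Haar^{⊗E}{F ≤ ε F(W₀)} ≤ C ε^c` for every `W₀` with `F(W₀) > 0`, `ε > 0`. -/
def FibreSmallBalls (T : ℝ → SU3) : Prop :=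
  ∀ (D n : ℕ), ∃ C c : ℝ, 0 < C ∧ 0 < c ∧
    ∀ (E : Type) [Fintype E] [DecidableEq E] (ι : Type) [Fintype ι] (r : ι → E), Fintype.card ι ≤ n →
    ∀ F : (E → SU3) → ℝ, Continuous F → (∀ W, 0 ≤ F W) →
      (∀ W W' : E → SU3, (∀ i, W (r i) = W' (r i)) → F W = F W') →
      (∀ (W : E → SU3) (i : ι) (A B : SU3), ∃ a : ℤ → ℂ, ∀ t : ℝ,
        ((F (Function.update W (r i) (A * T t * B)) ^ 2 : ℝ) : ℂ) =
          ∑ k ∈ Finset.Icc (-(D : ℤ)) D, a k * Complex.exp ((k : ℂ) * (t : ℂ) * Complex.I)) →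
      ∀ W₀ : E → SU3, 0 < F W₀ → ∀ ε : ℝ, 0 < ε →
        ((Measure.pi fun _ : E => haarProbability SU3) {W | F W ≤ ε * F W₀}).toReal ≤ C * ε ^ c

/-- (density-abstract) BALL-FREE UNTILT ON `SU(3)^E`.  For every `n` and `K` there are `C > 0`, `p` such that:
for every finite `E`, every list `r : ι → E` of at most `n` coordinates and every continuous `S` on `E → SU(3)`
depending only on the listed coordinates and `K`-Lipschitz along every circle `s ↦ W[r i ↦ A T(s) B]`, the
tilted law `e^{−βS} Haar^{⊗E}/Z` has density `≤ C (1+β)^p` for every `β ≥ 0`.  (Word coupling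
`Z = ∫ ⨍_{[−π,π]^m} e^{−βS(Φ_θ W)} dθ dHaar(W)` by left-invariance + Tonelli; the word fibre through ANY `W`
reaches a GLOBAL minimiser of `S` (surjectivity + dependence on listed coordinates; periodicity
`T(θ + 2π) = T(θ)` puts the angles in the box) and `S ∘ Φ_· W` is `K`-Lipschitz per angle, so
`Z ≥ e^{−βS_min−1}(h/2π)^m`, `h = min(π, 1/(βKm))`, while `e^{−βS} ≤ e^{−βS_min}`: density
`≤ e(2+2πKm)^m(1+β)^m`, `m = d·n`.) -/
def FibreDensity (T : ℝ → SU3) : Prop :=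
  ∀ (n : ℕ) (K : ℝ), ∃ C p : ℝ, 0 < C ∧
    ∀ (E : Type) [Fintype E] [DecidableEq E] (ι : Type) [Fintype ι] (r : ι → E), Fintype.card ι ≤ n →
    ∀ S : (E → SU3) → ℝ, Continuous S →
      (∀ W W' : E → SU3, (∀ i, W (r i) = W' (r i)) → S W = S W') →
      (∀ (W : E → SU3) (i : ι) (A B : SU3) (s s' : ℝ),
        |S (Function.update W (r i) (A * T s * B)) -
            S (Function.update W (r i) (A * T s' * B))| ≤ K * |s - s'|) →
      ∀ β : ℝ, 0 ≤ β → ∀ W : E → SU3,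
        Real.exp (-(β * S W)) /
            (∫ W', Real.exp (-(β * S W')) ∂(Measure.pi fun _ : E => haarProbability SU3)) ≤
          C * (1 + β) ^ p

/-! ## §2 The trunk (INLINED VERBATIM from `Lines/R1DensityReduction.lean`, ideator 3, crux-ideate r1;
re-checked rc 0 / 0 sorry / axioms {propext, Classical.choice, Quot.sound} by triage r1-1, r1-2, r1-3).
When the farm builds `Summits.QuantumFields.QCD.Cruxes.TiltedFlatness.Lines.R1DensityReduction`, replace this
section by that import + `open …R1DensityReduction`. -/

/-- (R1) GLOBAL RELATIVE SMALL BALLS under the untilted product Haar law, uniformly in masses,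
volume, outside and sites: `Haar{F ≤ ε F(W₀)} ≤ C ε^c` for every `W₀` with `F(W₀) > 0`.
[verbatim `R1DensityReduction.HaarRelativeSmallBalls`] -/
def HaarRelativeSmallBalls : Prop :=
  ∀ Nf : ℕ, ∃ C c : ℝ, 0 < C ∧ 0 < c ∧ ∀ mq : Fin Nf → ℝ, (∀ f, -2 ≤ mq f ∧ mq f ≤ 2) →
    ∀ (L : ℕ) [NeZero L], 4 ≤ L →
    ∀ (U : GaugeConfig 4 L (Matrix.specialUnitaryGroup (Fin 3) ℂ)) (x y : TorusSite 4 L),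
    let star : Edge 4 L → Prop := fun e => e.1 = x ∨ Site.shift e.1 e.2 = x ∨ e.1 = y ∨ Site.shift e.1 e.2 = y
    let refit : GaugeConfig 4 L (Matrix.specialUnitaryGroup (Fin 3) ℂ) →
        GaugeConfig 4 L (Matrix.specialUnitaryGroup (Fin 3) ℂ) := fun W e => if star e then W e else U e
    let F : GaugeConfig 4 L (Matrix.specialUnitaryGroup (Fin 3) ℂ) → ℝ :=
      fun W => ‖(diracMatrix (refit W) mq).det‖
    let haar : Measure (GaugeConfig 4 L (Matrix.specialUnitaryGroup (Fin 3) ℂ)) :=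
      Measure.pi fun _ => haarProbability (Matrix.specialUnitaryGroup (Fin 3) ℂ)
    ∀ (W₀ : GaugeConfig 4 L (Matrix.specialUnitaryGroup (Fin 3) ℂ)), 0 < F W₀ → ∀ ε : ℝ, 0 < ε →
      (haar {W | F W ≤ ε * F W₀}).toReal ≤ C * ε ^ c

/-- TILT DENSITY BOUND: the star-conditional Wilson law has density `wt/Z ≤ C (1+β)^p` against product Haar,
uniformly in the outside. [verbatim `R1DensityReduction.TiltDensityBound`] -/
def TiltDensityBound : Prop :=
  ∃ C p : ℝ, 0 < C ∧ ∀ β : ℝ, 0 ≤ β → ∀ (L : ℕ) [NeZero L], 4 ≤ L →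
    ∀ (U : GaugeConfig 4 L (Matrix.specialUnitaryGroup (Fin 3) ℂ)) (x y : TorusSite 4 L),
    let star : Edge 4 L → Prop := fun e => e.1 = x ∨ Site.shift e.1 e.2 = x ∨ e.1 = y ∨ Site.shift e.1 e.2 = y
    let refit : GaugeConfig 4 L (Matrix.specialUnitaryGroup (Fin 3) ℂ) →
        GaugeConfig 4 L (Matrix.specialUnitaryGroup (Fin 3) ℂ) := fun W e => if star e then W e else U e
    let wt : GaugeConfig 4 L (Matrix.specialUnitaryGroup (Fin 3) ℂ) → ℝ :=
      fun W => Real.exp (-(β * wilsonAction (fundamentalRep (Fin 3)) (refit W)))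
    let haar : Measure (GaugeConfig 4 L (Matrix.specialUnitaryGroup (Fin 3) ℂ)) :=
      Measure.pi fun _ => haarProbability (Matrix.specialUnitaryGroup (Fin 3) ℂ)
    let Z : ℝ := ∫ W, wt W ∂haar
    ∀ W, wt W / Z ≤ C * (1 + β) ^ p

/-- ABSTRACT FORM OF THE TRUNK, PROVED: on a compact space with a finite measure `μ`, a continuous amplitude
`F ≥ 0`, a continuous positive weight `w` with DENSITY BOUND `w/Z ≤ K`, and RELATIVE SMALL BALLS
`μ{F ≤ ε F(x₀)} ≤ C_R ε^c`: (a) `F(x₀) ≤ 2(2KC_R+1)^{1/c} · M` and (b) `∫ 1{F ≤ εM} w / Z ≤ K C_R ε^c`.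
[verbatim `R1DensityReduction.flatness_and_smallBalls_of_anticoncentration`] -/
theorem flatness_and_smallBalls_of_anticoncentration
    {X : Type*} [TopologicalSpace X] [CompactSpace X] [MeasurableSpace X] [OpensMeasurableSpace X]
    (μ : Measure X) [IsFiniteMeasure μ] {F w : X → ℝ} (hF : Continuous F) (hw : Continuous w)
    (hF0 : ∀ x, 0 ≤ F x) (hw0 : ∀ x, 0 ≤ w x) {K C_R c : ℝ} (hK : 0 ≤ K) (hCR : 0 ≤ C_R) (hc : 0 < c)
    (hZ : 0 < ∫ y, w y ∂μ) (hdens : ∀ x, w x ≤ K * ∫ y, w y ∂μ)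
    (hR1 : ∀ x₀, 0 < F x₀ → ∀ ε : ℝ, 0 < ε → (μ {x | F x ≤ ε * F x₀}).toReal ≤ C_R * ε ^ c) :
    (∀ x₀, F x₀ ≤ 2 * (2 * K * C_R + 1) ^ (1 / c) * ((∫ x, F x * w x ∂μ) / ∫ y, w y ∂μ)) ∧
    (0 < (∫ x, F x * w x ∂μ) / (∫ y, w y ∂μ) → ∀ ε : ℝ, 0 < ε →
      (∫ x, (if F x ≤ ε * ((∫ x, F x * w x ∂μ) / ∫ y, w y ∂μ) then (1 : ℝ) else 0) * w x ∂μ) /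
          (∫ y, w y ∂μ) ≤ K * C_R * ε ^ c) := by
  set Z : ℝ := ∫ y, w y ∂μ with hZdef
  have hwi : Integrable w μ := Summit.QuantumFields.QCD.Theorems.TiltedFlatnessNegative.integrable_of_continuous hw
  have hFwi : Integrable (fun x => F x * w x) μ :=
    Summit.QuantumFields.QCD.Theorems.TiltedFlatnessNegative.integrable_of_continuous (hF.mul hw)
  -- the weighted mass of a closed sublevel set `{F ≤ t}` is at most `K Z μ{F ≤ t}`
  have hmass : ∀ t : ℝ, ∫ x in {x | F x ≤ t}, w x ∂μ ≤ K * Z * (μ {x | F x ≤ t}).toReal := by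
    intro t
    have hmeas : MeasurableSet {x | F x ≤ t} := (isClosed_le hF continuous_const).measurableSet
    calc ∫ x in {x | F x ≤ t}, w x ∂μ ≤ ∫ x in {x | F x ≤ t}, K * Z ∂μ := by
          refine setIntegral_mono_on hwi.integrableOn (integrableOn_const) hmeas fun x _ => ?_
          exact hdens x
      _ = K * Z * (μ {x | F x ≤ t}).toReal := by
          rw [setIntegral_const, smul_eq_mul, mul_comm]; rfl
  by_cases hX : Nonempty X
  swap
  · haveI : IsEmpty X := not_nonempty_iff.mp hX
    refine ⟨fun x₀ => (IsEmpty.false x₀).elim, fun hM ε hε => ?_⟩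
    simp [integral_of_isEmpty] at hM
  obtain ⟨xm, -, hxm⟩ := isCompact_univ.exists_isMaxOn univ_nonempty hF.continuousOn
  have hFmax : ∀ x, F x ≤ F xm := fun x => hxm (mem_univ x)
  -- `M ≤ F xm`
  have hM_le : (∫ x, F x * w x ∂μ) / Z ≤ F xm := by
    rw [div_le_iff₀ hZ]
    calc ∫ x, F x * w x ∂μ ≤ ∫ x, F xm * w x ∂μ :=
          integral_mono hFwi (hwi.const_mul _) fun x => mul_le_mul_of_nonneg_right (hFmax x) (hw0 x)
      _ = F xm * Z := by rw [integral_const_mul]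
  constructor
  · -- (a) flatness
    intro x₀
    set A : ℝ := 2 * K * C_R + 1 with hA
    have hApos : 0 < A := by positivity
    set δ : ℝ := A ^ (-(1 / c)) with hδ
    have hδpos : 0 < δ := Real.rpow_pos_of_pos hApos _
    have hδc : δ ^ c = A⁻¹ := by
      rw [hδ, ← Real.rpow_mul hApos.le, neg_mul, one_div, inv_mul_cancel₀ hc.ne', Real.rpow_neg hApos.le,
        Real.rpow_one]
    have hinvδ : δ⁻¹ = A ^ (1 / c) := by
      rw [hδ, Real.rpow_neg hApos.le, inv_inv]
    by_cases hFm0 : F xm ≤ 0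
    · have h0 : F x₀ = 0 := le_antisymm ((hFmax x₀).trans hFm0) (hF0 x₀)
      rw [h0]
      refine mul_nonneg (by positivity) (div_nonneg (integral_nonneg fun x => ?_) hZ.le)
      exact mul_nonneg (hF0 x) (hw0 x)
    push Not at hFm0
    -- mass of the deep sublevel set `B = {F ≤ δ F xm}` is at most `K Z C_R δ^c ≤ Z/2`
    set B : Set X := {x | F x ≤ δ * F xm} with hB
    have hBmeas : MeasurableSet B := (isClosed_le hF continuous_const).measurableSet
    have hBmass : ∫ x in B, w x ∂μ ≤ Z / 2 := by
      calc ∫ x in B, w x ∂μ ≤ K * Z * (μ B).toReal := hmass _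
        _ ≤ K * Z * (C_R * δ ^ c) := by
            refine mul_le_mul_of_nonneg_left (hR1 xm hFm0 δ hδpos) (by positivity)
        _ = Z * (K * C_R / A) := by rw [hδc]; ring
        _ ≤ Z * (1 / 2) := by
            refine mul_le_mul_of_nonneg_left ?_ hZ.le
            rw [div_le_iff₀ hApos, hA]; nlinarith [mul_nonneg hK hCR]
        _ = Z / 2 := by ring
    -- lower bound for `∫ F w` on the complement of `B`
    have hlow : δ * F xm * (Z / 2) ≤ ∫ x, F x * w x ∂μ := by
      have hcompl : ∫ x in Bᶜ, w x ∂μ = Z - ∫ x in B, w x ∂μ := setIntegral_compl hBmeas hwi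
      have h1 : δ * F xm * (Z / 2) ≤ δ * F xm * ∫ x in Bᶜ, w x ∂μ := by
        refine mul_le_mul_of_nonneg_left ?_ (by positivity)
        rw [hcompl]; linarith
      have h2 : δ * F xm * ∫ x in Bᶜ, w x ∂μ = ∫ x in Bᶜ, δ * F xm * w x ∂μ := by
        rw [integral_const_mul]
      have h3 : ∫ x in Bᶜ, δ * F xm * w x ∂μ ≤ ∫ x in Bᶜ, F x * w x ∂μ := by
        refine setIntegral_mono_on ((hwi.const_mul _).integrableOn) hFwi.integrableOn hBmeas.compl
          fun x hx => ?_
        have hx' : δ * F xm < F x := by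
          simpa [hB] using hx
        exact mul_le_mul_of_nonneg_right hx'.le (hw0 x)
      have h4 : ∫ x in Bᶜ, F x * w x ∂μ ≤ ∫ x, F x * w x ∂μ :=
        setIntegral_le_integral hFwi (Eventually.of_forall fun x => mul_nonneg (hF0 x) (hw0 x))
      linarith
    -- conclude
    set I : ℝ := ∫ x, F x * w x ∂μ with hI
    have hδne : δ ≠ 0 := hδpos.ne'
    have hZne : Z ≠ 0 := hZ.ne'
    have h1 : F xm * (δ * Z) ≤ I * 2 := by
      have : F xm * (δ * Z) = 2 * (δ * F xm * (Z / 2)) := by ring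
      linarith
    have hkey : F xm ≤ 2 * δ⁻¹ * (I / Z) := by
      calc F xm = F xm * (δ * Z) / (δ * Z) := by field_simp
        _ ≤ I * 2 / (δ * Z) := by gcongr
        _ = 2 * δ⁻¹ * (I / Z) := by field_simp
    calc F x₀ ≤ F xm := hFmax x₀
      _ ≤ 2 * δ⁻¹ * (I / Z) := hkey
      _ = 2 * A ^ (1 / c) * (I / Z) := by rw [hinvδ]
  · -- (b′) relative small balls
    intro hM ε hε
    set M : ℝ := (∫ x, F x * w x ∂μ) / Z with hMdef
    have hFm : 0 < F xm := lt_of_lt_of_le hM hM_le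
    have hsub : {x | F x ≤ ε * M} ⊆ {x | F x ≤ ε * F xm} := fun x hx =>
      le_trans (show F x ≤ ε * M from hx) (mul_le_mul_of_nonneg_left hM_le hε.le)
    have hmeas : MeasurableSet {x | F x ≤ ε * M} := (isClosed_le hF continuous_const).measurableSet
    have hind : ∫ x, (if F x ≤ ε * M then (1 : ℝ) else 0) * w x ∂μ = ∫ x in {x | F x ≤ ε * M}, w x ∂μ := by
      rw [← integral_indicator hmeas]
      congr 1; ext x
      by_cases hx : F x ≤ ε * M
      · simp [hx]
      · simp [hx]
    rw [hind, div_le_iff₀ hZ]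
    calc ∫ x in {x | F x ≤ ε * M}, w x ∂μ ≤ K * Z * (μ {x | F x ≤ ε * M}).toReal := hmass _
      _ ≤ K * Z * (μ {x | F x ≤ ε * F xm}).toReal := by
          refine mul_le_mul_of_nonneg_left ?_ (by positivity)
          exact ENNReal.toReal_mono (measure_ne_top _ _) (measure_mono hsub)
      _ ≤ K * Z * (C_R * ε ^ c) := mul_le_mul_of_nonneg_left (hR1 xm hFm ε hε) (by positivity)
      _ = K * C_R * ε ^ c * Z := by ring

/-- STRUCTURAL REDUCTION (both clauses): (R1) + density bound ⇒ the crux.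
[verbatim `R1DensityReduction.CruxOfR1Density`; stated through this `def` so that the only theorem of this
file whose type is LITERALLY the route decl is `TiltedFlatness_of`.] -/
def CruxOfR1Density : Prop := HaarRelativeSmallBalls → TiltDensityBound → TiltedFlatness

/-- PROVED TRUNK: the crux `TiltedFlatness` (item 14070, both clauses) follows from (R1) `HaarRelativeSmallBalls`
and the sandwich `TiltDensityBound`, with `C = max(2(2C_DC_R+1)^{1/c}, C_DC_R)`, `p = max(p₀⁺/c, p₀⁺)`, same `c`.
[verbatim `R1DensityReduction.tiltedFlatness_of_R1_density`, proof unchanged] -/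
theorem tiltedFlatness_of_R1_density : CruxOfR1Density := by
  show HaarRelativeSmallBalls → TiltDensityBound → TiltedFlatness
  intro hR1 hD Nf
  obtain ⟨C_R, c, hCR, hc, hR⟩ := hR1 Nf
  obtain ⟨C_D, p₀, hCD, hDD⟩ := hD
  set P : ℝ := max (max p₀ 0 / c) (max p₀ 0) with hP
  set Cbig : ℝ := max (2 * (2 * C_D * C_R + 1) ^ (1 / c)) (C_D * C_R) with hCbig
  refine ⟨Cbig, P, c, lt_max_of_lt_right (mul_pos hCD hCR), hc, ?_⟩
  intro β hβ mq hmq L _ hL U x y star refit F wt haar Z M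
  -- continuity of the carriers
  have hrefit : Continuous refit := by
    refine continuous_pi fun e => ?_
    by_cases h : star e
    · simp only [refit, if_pos h]; exact continuous_apply e
    · simp only [refit, if_neg h]; exact continuous_const
  have hFc : Continuous F :=
    continuous_norm.comp
      (((Summit.QuantumFields.QCD.Theorems.TiltedFlatnessNegative.continuous_diracMatrix mq).comp
        hrefit).matrix_det)
  have hSc : Continuous fun W => wilsonAction (fundamentalRep (Fin 3)) (refit W) :=
    (Summit.QuantumFields.QCD.Theorems.TiltedFlatnessNegative.continuous_wilsonAction
      (fundamentalRep (Fin 3)) (continuous_fundamentalRep (Fin 3))).comp hrefit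
  have hwtc : Continuous wt := Real.continuous_exp.comp ((continuous_const.mul hSc).neg)
  have hF0 : ∀ W, 0 ≤ F W := fun W => norm_nonneg _
  have hwt0 : ∀ W, 0 < wt W := fun W => Real.exp_pos _
  haveI : IsProbabilityMeasure haar := by
    show IsProbabilityMeasure (Measure.pi fun _ => haarProbability (Matrix.specialUnitaryGroup (Fin 3) ℂ))
    infer_instance
  -- `Z > 0`
  have hZ : 0 < Z := by
    obtain ⟨Wm, -, hWm⟩ := isCompact_univ.exists_isMinOn univ_nonempty hwtc.continuousOn
    have hle : ∫ W, wt Wm ∂haar ≤ Z :=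
      integral_mono (integrable_const _)
        (Summit.QuantumFields.QCD.Theorems.TiltedFlatnessNegative.integrable_of_continuous hwtc)
        fun W => hWm (mem_univ W)
    have hc' : ∫ W, wt Wm ∂haar = wt Wm := by simp
    linarith [hwt0 Wm]
  -- density bound and small balls, read off the hypotheses (the `let`s agree definitionally)
  have h1β : (1 : ℝ) ≤ 1 + β := by linarith
  set t : ℝ := (1 + β) ^ (max p₀ 0) with ht
  have ht1 : 1 ≤ t := Real.one_le_rpow h1β (le_max_right _ _)
  have hKle : C_D * (1 + β) ^ p₀ ≤ C_D * t :=
    mul_le_mul_of_nonneg_left (Real.rpow_le_rpow_of_exponent_le h1β (le_max_left _ _)) hCD.le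
  have hdens : ∀ W, wt W ≤ C_D * t * Z := by
    intro W
    have h := hDD β hβ L hL U x y W
    have h' : wt W / Z ≤ C_D * (1 + β) ^ p₀ := h
    rw [div_le_iff₀ hZ] at h'
    exact h'.trans (mul_le_mul_of_nonneg_right hKle hZ.le)
  have hR1' : ∀ W₀, 0 < F W₀ → ∀ ε : ℝ, 0 < ε → (haar {W | F W ≤ ε * F W₀}).toReal ≤ C_R * ε ^ c :=
    fun W₀ hW₀ ε hε => hR mq hmq L hL U x y W₀ hW₀ ε hε
  obtain ⟨ha, hb⟩ := flatness_and_smallBalls_of_anticoncentration haar hFc hwtc hF0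
    (fun W => (hwt0 W).le) (by positivity : 0 ≤ C_D * t) hCR.le hc hZ hdens hR1'
  -- constants: `(2 C_D t C_R + 1)^{1/c} ≤ (2 C_D C_R + 1)^{1/c} t^{1/c}` and `t^{1/c}, t ≤ (1+β)^P`
  have hA : 2 * (C_D * t) * C_R + 1 ≤ (2 * C_D * C_R + 1) * t := by nlinarith [mul_pos hCD hCR]
  have htP1 : t ^ (1 / c) ≤ (1 + β) ^ P := by
    rw [ht, ← Real.rpow_mul (by linarith), mul_one_div]
    exact Real.rpow_le_rpow_of_exponent_le h1β (le_max_left _ _)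
  have htP2 : t ≤ (1 + β) ^ P := Real.rpow_le_rpow_of_exponent_le h1β (le_max_right _ _)
  have hM0 : 0 ≤ M := div_nonneg (integral_nonneg fun W => mul_nonneg (hF0 W) (hwt0 W).le) hZ.le
  refine ⟨fun W₀ => (ha W₀).trans ?_, fun hM ε hε => (hb hM ε hε).trans ?_⟩
  · have h2 : (2 * (C_D * t) * C_R + 1) ^ (1 / c) ≤ (2 * C_D * C_R + 1) ^ (1 / c) * (1 + β) ^ P := by
      calc (2 * (C_D * t) * C_R + 1) ^ (1 / c) ≤ ((2 * C_D * C_R + 1) * t) ^ (1 / c) :=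
            Real.rpow_le_rpow (by positivity) hA (by positivity)
        _ = (2 * C_D * C_R + 1) ^ (1 / c) * t ^ (1 / c) := Real.mul_rpow (by positivity) (by positivity)
        _ ≤ (2 * C_D * C_R + 1) ^ (1 / c) * (1 + β) ^ P :=
            mul_le_mul_of_nonneg_left htP1 (by positivity)
    calc 2 * (2 * (C_D * t) * C_R + 1) ^ (1 / c) * M
        ≤ 2 * ((2 * C_D * C_R + 1) ^ (1 / c) * (1 + β) ^ P) * M := by gcongr
      _ = (2 * (2 * C_D * C_R + 1) ^ (1 / c)) * (1 + β) ^ P * M := by ring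
      _ ≤ Cbig * (1 + β) ^ P * M := by gcongr; exact le_max_left _ _
  · calc C_D * t * C_R * ε ^ c = (C_D * C_R) * t * ε ^ c := by ring
      _ ≤ Cbig * (1 + β) ^ P * ε ^ c := by
          gcongr
          · exact le_max_right _ _

/-! ## §3 Glue (sorry-free): the listed star edges, `refit ∘ update`, abstract ⇒ concrete -/

/-- The `16` listed edges covering `star(x) ∪ star(y)`: `(x,μ)`, `(x−μ̂,μ)`, `(y,μ)`, `(y−μ̂,μ)`. -/
def starEdge {L : ℕ} (x y : TorusSite 4 L) : (Fin 4 ⊕ Fin 4) ⊕ (Fin 4 ⊕ Fin 4) → Edge 4 L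
  | Sum.inl (Sum.inl μ) => (x, μ)
  | Sum.inl (Sum.inr μ) => (x - Pi.single μ 1, μ)
  | Sum.inr (Sum.inl μ) => (y, μ)
  | Sum.inr (Sum.inr μ) => (y - Pi.single μ 1, μ)

/-- Every star edge is listed. -/
theorem starEdge_cover {L : ℕ} (x y : TorusSite 4 L) (e : Edge 4 L)
    (he : e.1 = x ∨ Site.shift e.1 e.2 = x ∨ e.1 = y ∨ Site.shift e.1 e.2 = y) :
    ∃ i, starEdge x y i = e := by
  obtain ⟨z, μ⟩ := e
  rcases he with h | h | h | h
  · exact ⟨Sum.inl (Sum.inl μ), Prod.ext h.symm rfl⟩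
  · refine ⟨Sum.inl (Sum.inr μ), Prod.ext ?_ rfl⟩
    show x - Pi.single μ 1 = z
    rw [← h]
    exact add_sub_cancel_right z _
  · exact ⟨Sum.inr (Sum.inl μ), Prod.ext h.symm rfl⟩
  · refine ⟨Sum.inr (Sum.inr μ), Prod.ext ?_ rfl⟩
    show y - Pi.single μ 1 = z
    rw [← h]
    exact add_sub_cancel_right z _

/-- Every listed edge is a star edge. -/
theorem star_starEdge {L : ℕ} (x y : TorusSite 4 L) (i : (Fin 4 ⊕ Fin 4) ⊕ (Fin 4 ⊕ Fin 4)) :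
    (starEdge x y i).1 = x ∨ Site.shift (starEdge x y i).1 (starEdge x y i).2 = x ∨
      (starEdge x y i).1 = y ∨ Site.shift (starEdge x y i).1 (starEdge x y i).2 = y := by
  rcases i with (μ | μ) | (μ | μ)
  · exact Or.inl rfl
  · exact Or.inr (Or.inl (sub_add_cancel x _))
  · exact Or.inr (Or.inr (Or.inl rfl))
  · exact Or.inr (Or.inr (Or.inr (sub_add_cancel y _)))

theorem card_starIndex : Fintype.card ((Fin 4 ⊕ Fin 4) ⊕ (Fin 4 ⊕ Fin 4)) ≤ 16 := by
  simp


/-- Abstract ⇒ concrete, (R1): `FibreSmallBalls` (with the band limit) gives `HaarRelativeSmallBalls` for the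
crux's own `F = ‖det diracMatrix ∘ refit‖`. -/
theorem haarRelativeSmallBalls_of {T : ℝ → SU3} (hB : BandLimit T) (hFS : FibreSmallBalls T) :
    HaarRelativeSmallBalls := by
  intro Nf
  obtain ⟨C, c, hC, hc, hR⟩ := hFS (48 * Nf) 16
  refine ⟨C, c, hC, hc, ?_⟩
  intro mq hmq L _ hL U x y star refit F haar W₀ hW₀ ε hε
  have hrefit : Continuous refit := by
    refine continuous_pi fun e => ?_
    by_cases h : star e
    · simp only [refit, if_pos h]; exact continuous_apply e
    · simp only [refit, if_neg h]; exact continuous_const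
  have hFc : Continuous F :=
    continuous_norm.comp
      (((Summit.QuantumFields.QCD.Theorems.TiltedFlatnessNegative.continuous_diracMatrix mq).comp
        hrefit).matrix_det)
  have hF0 : ∀ W, 0 ≤ F W := fun W => norm_nonneg _
  -- `refit` commutes with updating a star link
  have hupd : ∀ e, star e → ∀ (W : GaugeConfig 4 L (Matrix.specialUnitaryGroup (Fin 3) ℂ))
      (g : Matrix.specialUnitaryGroup (Fin 3) ℂ),
      refit (Function.update W e g) = Function.update (refit W) e g := by
    intro e he W g
    funext e'
    by_cases h : e' = e
    · subst h
      simp only [refit, Function.update_self, if_pos he]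
    · simp only [refit, Function.update_of_ne h]
  -- `F` depends only on the listed links
  have hRR : ∀ W W' : GaugeConfig 4 L (Matrix.specialUnitaryGroup (Fin 3) ℂ),
      (∀ i, W (starEdge x y i) = W' (starEdge x y i)) → refit W = refit W' := by
    intro W W' h
    funext e
    by_cases he : star e
    · obtain ⟨i, rfl⟩ := starEdge_cover x y e he
      simp only [refit, if_pos he, h i]
    · simp only [refit, if_neg he]
  have hdep : ∀ W W' : GaugeConfig 4 L (Matrix.specialUnitaryGroup (Fin 3) ℂ),
      (∀ i, W (starEdge x y i) = W' (starEdge x y i)) → F W = F W' := by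
    intro W W' h
    simp only [F, hRR W W' h]
  -- band limit along every circle at a listed link
  have hband : ∀ (W : GaugeConfig 4 L (Matrix.specialUnitaryGroup (Fin 3) ℂ))
      (i : (Fin 4 ⊕ Fin 4) ⊕ (Fin 4 ⊕ Fin 4)) (A B : Matrix.specialUnitaryGroup (Fin 3) ℂ),
      ∃ a : ℤ → ℂ, ∀ t : ℝ,
        ((F (Function.update W (starEdge x y i) (A * T t * B)) ^ 2 : ℝ) : ℂ) =
          ∑ k ∈ Finset.Icc (-((48 * Nf : ℕ) : ℤ)) ((48 * Nf : ℕ) : ℤ),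
            a k * Complex.exp ((k : ℂ) * (t : ℂ) * Complex.I) := by
    intro W i A B
    have he := star_starEdge x y i
    obtain ⟨a, ha⟩ := hB Nf mq L hL (refit W) (starEdge x y i) A B
    refine ⟨a, fun t => ?_⟩
    simpa only [F, hupd _ he] using ha t
  exact hR (Edge 4 L) ((Fin 4 ⊕ Fin 4) ⊕ (Fin 4 ⊕ Fin 4)) (starEdge x y) card_starIndex F hFc hF0 hdep hband
    W₀ hW₀ ε hε

/-- Abstract ⇒ concrete, density: `FibreDensity` (with the action's Lipschitz bound) gives `TiltDensityBound`
for the crux's own `wt = e^{-β·wilsonAction ∘ refit}`. -/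
theorem tiltDensityBound_of {T : ℝ → SU3} (hL : ActionLipschitz T) (hFD : FibreDensity T) :
    TiltDensityBound := by
  obtain ⟨K, hK0, hK⟩ := hL
  obtain ⟨C, p, hC, hD⟩ := hFD 16 K
  refine ⟨C, p, hC, ?_⟩
  intro β hβ L _ hL4 U x y star refit wt haar Z W
  have hrefit : Continuous refit := by
    refine continuous_pi fun e => ?_
    by_cases h : star e
    · simp only [refit, if_pos h]; exact continuous_apply e
    · simp only [refit, if_neg h]; exact continuous_const
  have hSc : Continuous fun W => wilsonAction (fundamentalRep (Fin 3)) (refit W) :=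
    (Summit.QuantumFields.QCD.Theorems.TiltedFlatnessNegative.continuous_wilsonAction
      (fundamentalRep (Fin 3)) (continuous_fundamentalRep (Fin 3))).comp hrefit
  have hupd : ∀ e, star e → ∀ (W : GaugeConfig 4 L (Matrix.specialUnitaryGroup (Fin 3) ℂ))
      (g : Matrix.specialUnitaryGroup (Fin 3) ℂ),
      refit (Function.update W e g) = Function.update (refit W) e g := by
    intro e he W g
    funext e'
    by_cases h : e' = e
    · subst h
      simp only [refit, Function.update_self, if_pos he]
    · simp only [refit, Function.update_of_ne h]
  have hRR : ∀ W W' : GaugeConfig 4 L (Matrix.specialUnitaryGroup (Fin 3) ℂ),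
      (∀ i, W (starEdge x y i) = W' (starEdge x y i)) → refit W = refit W' := by
    intro W W' h
    funext e
    by_cases he : star e
    · obtain ⟨i, rfl⟩ := starEdge_cover x y e he
      simp only [refit, if_pos he, h i]
    · simp only [refit, if_neg he]
  have hdep : ∀ W W' : GaugeConfig 4 L (Matrix.specialUnitaryGroup (Fin 3) ℂ),
      (∀ i, W (starEdge x y i) = W' (starEdge x y i)) →
      wilsonAction (fundamentalRep (Fin 3)) (refit W) = wilsonAction (fundamentalRep (Fin 3)) (refit W') := by
    intro W W' h
    rw [hRR W W' h]
  have hlip : ∀ (W : GaugeConfig 4 L (Matrix.specialUnitaryGroup (Fin 3) ℂ))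
      (i : (Fin 4 ⊕ Fin 4) ⊕ (Fin 4 ⊕ Fin 4)) (A B : Matrix.specialUnitaryGroup (Fin 3) ℂ) (s s' : ℝ),
      |wilsonAction (fundamentalRep (Fin 3)) (refit (Function.update W (starEdge x y i) (A * T s * B))) -
          wilsonAction (fundamentalRep (Fin 3))
            (refit (Function.update W (starEdge x y i) (A * T s' * B)))| ≤ K * |s - s'| := by
    intro W i A B s s'
    have he := star_starEdge x y i
    rw [hupd _ he, hupd _ he]
    exact hK L hL4 (refit W) (starEdge x y i) A B s s'
  exact hD (Edge 4 L) ((Fin 4 ⊕ Fin 4) ⊕ (Fin 4 ⊕ Fin 4)) (starEdge x y) card_starIndex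
    (fun W => wilsonAction (fundamentalRep (Fin 3)) (refit W)) hSc hdep hlip β hβ W

/-! ## §4 The stubs (the seven lemmas of the line, EXPANDED signatures = what the helper files landed; ALL CLOSED —
each is now the landed theorem of `Theorems/PauliWegnerSeaTiltedFlatnessStub*.lean`, namespace
`Summit.QuantumFields.QCD.Theorems.CircleTransport`; the closing file is `Theorems/PauliWegnerSeaTiltedFlatness.lean`,
`TiltedFlatness_proof`) -/

/-- STUB 1 (P, size M–L): two-sided band limit of the sea at one link, crude degree `≤ 48 N_f`, `L ≥ 4`. -/
theorem stub_bandLimit : ∀ T : ℝ → SU3,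
    (∀ θ : ℝ, ((T θ : SU3) : Matrix (Fin 3) (Fin 3) ℂ) =
      Matrix.diagonal ![Complex.exp (θ * Complex.I), Complex.exp (-(θ * Complex.I)), 1]) →
    ∀ (Nf : ℕ) (mq : Fin Nf → ℝ) (L : ℕ) [NeZero L], 4 ≤ L →
    ∀ (U : GaugeConfig 4 L SU3) (e : Edge 4 L) (A B : SU3),
    ∃ a : ℤ → ℂ, ∀ s : ℝ,
      ((‖(diracMatrix (Function.update U e (A * T s * B)) mq).det‖ ^ 2 : ℝ) : ℂ) =
        ∑ k ∈ Finset.Icc (-((48 * Nf : ℕ) : ℤ)) ((48 * Nf : ℕ) : ℤ),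
          a k * Complex.exp ((k : ℂ) * (s : ℂ) * Complex.I) :=
  Summit.QuantumFields.QCD.Theorems.CircleTransport.stub_bandLimit

/-- STUB 2 (L, size S–M): the Wilson action is `K`-Lipschitz along the circle at one link, `L ≥ 4`. -/
theorem stub_actionLipschitz : ∀ T : ℝ → SU3,
    (∀ θ : ℝ, ((T θ : SU3) : Matrix (Fin 3) (Fin 3) ℂ) =
      Matrix.diagonal ![Complex.exp (θ * Complex.I), Complex.exp (-(θ * Complex.I)), 1]) →
    ∃ K : ℝ, 0 ≤ K ∧ ∀ (L : ℕ) [NeZero L], 4 ≤ L →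
      ∀ (U : GaugeConfig 4 L SU3) (e : Edge 4 L) (A B : SU3) (s s' : ℝ),
      |wilsonAction (fundamentalRep (Fin 3)) (Function.update U e (A * T s * B)) -
          wilsonAction (fundamentalRep (Fin 3)) (Function.update U e (A * T s' * B))| ≤ K * |s - s'| :=
  Summit.QuantumFields.QCD.Theorems.CircleTransport.stub_actionLipschitz

/-- STUB 3 (E, size M): surjective word of conjugated circles. -/
theorem stub_eulerWord : ∀ T : ℝ → SU3,
    (∀ θ : ℝ, ((T θ : SU3) : Matrix (Fin 3) (Fin 3) ℂ) =
      Matrix.diagonal ![Complex.exp (θ * Complex.I), Complex.exp (-(θ * Complex.I)), 1]) →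
    ∃ (d : ℕ) (V : Fin d → SU3), ∀ g : SU3, ∃ s : Fin d → ℝ,
      g = (List.ofFn fun j => V j * T (s j) * (V j)⁻¹).prod :=
  Summit.QuantumFields.QCD.Theorems.CircleTransport.stub_eulerWord

/-- STUB 4 (N + SB, size M; the 1-D engine): Nikolskii's inequality and mean-relative small balls for
non-negative trigonometric polynomials. -/
theorem stub_circleEngine :
    (∀ (D : ℕ) (f : ℝ → ℝ),
      (∃ a : ℤ → ℂ, ∀ t : ℝ, ((f t : ℝ) : ℂ) =
        ∑ k ∈ Finset.Icc (-(D : ℤ)) D, a k * Complex.exp ((k : ℂ) * (t : ℂ) * Complex.I)) →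
      (∀ t, 0 ≤ f t) → ∀ t : ℝ, f t ≤ (2 * D + 1) * ((∫ s in Set.Icc (-π) π, f s) / (2 * π))) ∧
    (∀ D : ℕ, ∃ C c : ℝ, 0 < C ∧ 0 < c ∧ ∀ f : ℝ → ℝ,
      (∃ a : ℤ → ℂ, ∀ t : ℝ, ((f t : ℝ) : ℂ) =
        ∑ k ∈ Finset.Icc (-(D : ℤ)) D, a k * Complex.exp ((k : ℂ) * (t : ℂ) * Complex.I)) →
      (∀ t, 0 ≤ f t) → 0 < ∫ t in Set.Icc (-π) π, f t → ∀ ε : ℝ, 0 < ε →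
        volume {t ∈ Set.Icc (-π) π | f t ≤ ε * ((∫ s in Set.Icc (-π) π, f s) / (2 * π))} ≤
          ENNReal.ofReal (C * ε ^ c)) :=
  Summit.QuantumFields.QCD.Theorems.CircleTransport.stub_circleEngine

/-- STUB 5 (TSB, size L): small balls on the flat torus for separately band-limited continuous `q ≥ 0`,
from Nikolskii + the 1-D engine by slice induction. -/
theorem stub_torusSmallBalls :
    (∀ (D : ℕ) (f : ℝ → ℝ),
      (∃ a : ℤ → ℂ, ∀ t : ℝ, ((f t : ℝ) : ℂ) =
        ∑ k ∈ Finset.Icc (-(D : ℤ)) D, a k * Complex.exp ((k : ℂ) * (t : ℂ) * Complex.I)) →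
      (∀ t, 0 ≤ f t) → ∀ t : ℝ, f t ≤ (2 * D + 1) * ((∫ s in Set.Icc (-π) π, f s) / (2 * π))) →
    (∀ D : ℕ, ∃ C c : ℝ, 0 < C ∧ 0 < c ∧ ∀ f : ℝ → ℝ,
      (∃ a : ℤ → ℂ, ∀ t : ℝ, ((f t : ℝ) : ℂ) =
        ∑ k ∈ Finset.Icc (-(D : ℤ)) D, a k * Complex.exp ((k : ℂ) * (t : ℂ) * Complex.I)) →
      (∀ t, 0 ≤ f t) → 0 < ∫ t in Set.Icc (-π) π, f t → ∀ ε : ℝ, 0 < ε →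
        volume {t ∈ Set.Icc (-π) π | f t ≤ ε * ((∫ s in Set.Icc (-π) π, f s) / (2 * π))} ≤
          ENNReal.ofReal (C * ε ^ c)) →
    ∀ (m D : ℕ), ∃ C c : ℝ, 0 < C ∧ 0 < c ∧ ∀ q : (Fin m → ℝ) → ℝ, Continuous q → (∀ θ, 0 ≤ q θ) →
      (∀ (θ : Fin m → ℝ) (j : Fin m), ∃ a : ℤ → ℂ, ∀ t : ℝ, ((q (Function.update θ j t) : ℝ) : ℂ) =
        ∑ k ∈ Finset.Icc (-(D : ℤ)) D, a k * Complex.exp ((k : ℂ) * (t : ℂ) * Complex.I)) →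
      ∀ θ₀ : Fin m → ℝ, 0 < q θ₀ → ∀ η : ℝ, 0 < η →
        (volume {θ ∈ Set.Icc (fun _ : Fin m => -π) (fun _ => π) | q θ ≤ η * q θ₀}).toReal ≤ C * η ^ c :=
  Summit.QuantumFields.QCD.Theorems.CircleTransport.stub_torusSmallBalls

/-- STUB 6 (THE LEAD'S STUB, size M–L): word coupling + ontoness — a surjective word and the flat-torus small
balls give `FibreSmallBalls`. -/
theorem stub_haarSmallBalls : ∀ T : ℝ → SU3,
    (∀ θ : ℝ, ((T θ : SU3) : Matrix (Fin 3) (Fin 3) ℂ) =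
      Matrix.diagonal ![Complex.exp (θ * Complex.I), Complex.exp (-(θ * Complex.I)), 1]) →
    (∃ (d : ℕ) (V : Fin d → SU3), ∀ g : SU3, ∃ s : Fin d → ℝ,
      g = (List.ofFn fun j => V j * T (s j) * (V j)⁻¹).prod) →
    (∀ (m D : ℕ), ∃ C c : ℝ, 0 < C ∧ 0 < c ∧ ∀ q : (Fin m → ℝ) → ℝ, Continuous q → (∀ θ, 0 ≤ q θ) →
      (∀ (θ : Fin m → ℝ) (j : Fin m), ∃ a : ℤ → ℂ, ∀ t : ℝ, ((q (Function.update θ j t) : ℝ) : ℂ) =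
        ∑ k ∈ Finset.Icc (-(D : ℤ)) D, a k * Complex.exp ((k : ℂ) * (t : ℂ) * Complex.I)) →
      ∀ θ₀ : Fin m → ℝ, 0 < q θ₀ → ∀ η : ℝ, 0 < η →
        (volume {θ ∈ Set.Icc (fun _ : Fin m => -π) (fun _ => π) | q θ ≤ η * q θ₀}).toReal ≤ C * η ^ c) →
    ∀ (D n : ℕ), ∃ C c : ℝ, 0 < C ∧ 0 < c ∧
      ∀ (E : Type) [Fintype E] [DecidableEq E] (ι : Type) [Fintype ι] (r : ι → E), Fintype.card ι ≤ n →
      ∀ F : (E → SU3) → ℝ, Continuous F → (∀ W, 0 ≤ F W) →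
        (∀ W W' : E → SU3, (∀ i, W (r i) = W' (r i)) → F W = F W') →
        (∀ (W : E → SU3) (i : ι) (A B : SU3), ∃ a : ℤ → ℂ, ∀ t : ℝ,
          ((F (Function.update W (r i) (A * T t * B)) ^ 2 : ℝ) : ℂ) =
            ∑ k ∈ Finset.Icc (-(D : ℤ)) D, a k * Complex.exp ((k : ℂ) * (t : ℂ) * Complex.I)) →
        ∀ W₀ : E → SU3, 0 < F W₀ → ∀ ε : ℝ, 0 < ε →
          ((Measure.pi fun _ : E => haarProbability SU3) {W | F W ≤ ε * F W₀}).toReal ≤ C * ε ^ c :=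
  Summit.QuantumFields.QCD.Theorems.CircleTransport.stub_haarSmallBalls

/-- STUB 7 (THE UNTILT, size M): a surjective word gives the ball-free density bound `FibreDensity`. -/
theorem stub_circleUntilt : ∀ T : ℝ → SU3,
    (∀ θ : ℝ, ((T θ : SU3) : Matrix (Fin 3) (Fin 3) ℂ) =
      Matrix.diagonal ![Complex.exp (θ * Complex.I), Complex.exp (-(θ * Complex.I)), 1]) →
    (∃ (d : ℕ) (V : Fin d → SU3), ∀ g : SU3, ∃ s : Fin d → ℝ,
      g = (List.ofFn fun j => V j * T (s j) * (V j)⁻¹).prod) →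
    ∀ (n : ℕ) (K : ℝ), ∃ C p : ℝ, 0 < C ∧
      ∀ (E : Type) [Fintype E] [DecidableEq E] (ι : Type) [Fintype ι] (r : ι → E), Fintype.card ι ≤ n →
      ∀ S : (E → SU3) → ℝ, Continuous S →
        (∀ W W' : E → SU3, (∀ i, W (r i) = W' (r i)) → S W = S W') →
        (∀ (W : E → SU3) (i : ι) (A B : SU3) (s s' : ℝ),
          |S (Function.update W (r i) (A * T s * B)) -
              S (Function.update W (r i) (A * T s' * B))| ≤ K * |s - s'|) →
        ∀ β : ℝ, 0 ≤ β → ∀ W : E → SU3,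
          Real.exp (-(β * S W)) /
              (∫ W', Real.exp (-(β * S W')) ∂(Measure.pi fun _ : E => haarProbability SU3)) ≤
            C * (1 + β) ^ p :=
  Summit.QuantumFields.QCD.Theorems.CircleTransport.stub_circleUntilt

/-! ## §5 The composition (kernel-checked; concludes the crux BY NAME) -/

/-- The stub signatures ARE the currency Props (definitional bookkeeping, `Iff.rfl`-style checks). -/
example (T : ℝ → SU3) (hT : IsDiagCircle T) : BandLimit T := stub_bandLimit T hT
example (T : ℝ → SU3) (hT : IsDiagCircle T) : ActionLipschitz T := stub_actionLipschitz T hT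
example (T : ℝ → SU3) (hT : IsDiagCircle T) : EulerWord T := stub_eulerWord T hT
example : Nikolskii ∧ CircleSmallBall := stub_circleEngine
example : Nikolskii → CircleSmallBall → TorusSmallBalls := stub_torusSmallBalls
example (T : ℝ → SU3) (hT : IsDiagCircle T) : EulerWord T → TorusSmallBalls → FibreSmallBalls T :=
  stub_haarSmallBalls T hT
example (T : ℝ → SU3) (hT : IsDiagCircle T) : EulerWord T → FibreDensity T := stub_circleUntilt T hT

/-- The crux as a consequence of the seven stub statements at a diagonal circle family `T` (a `def`, so that
its proof below is not itself a by-name candidate of the skeleton audit). -/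
def CruxOfCircleTransport : Prop :=
  ∀ T : ℝ → SU3, IsDiagCircle T → BandLimit T → ActionLipschitz T → EulerWord T → Nikolskii → CircleSmallBall →
    (Nikolskii → CircleSmallBall → TorusSmallBalls) → (EulerWord T → TorusSmallBalls → FibreSmallBalls T) →
    (EulerWord T → FibreDensity T) → TiltedFlatness

/-- **`TiltedFlatness` from the seven stub statements** (no `sorry`; axioms {propext, Classical.choice,
Quot.sound}): band limit + (word, torus small balls ⇒ fibre small balls) ⇒ (R1); Lipschitz + untilt ⇒ density;
trunk. -/
theorem cruxOfCircleTransport_holds : CruxOfCircleTransport :=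
  fun _T _hT hB hL hW hN hSB hTSB hFS hU =>
    tiltedFlatness_of_R1_density (haarRelativeSmallBalls_of hB (hFS hW (hTSB hN hSB)))
      (tiltDensityBound_of hL (hU hW))

/-- **The skeleton theorem**: the crux BY NAME, modulo the seven registered stubs, at `T := diagCircle`. -/
theorem TiltedFlatness_of : Summit.QuantumFields.QCD.Theses.PauliWegnerSea.TiltedFlatness :=
  cruxOfCircleTransport_holds diagCircle isDiagCircle_diagCircle
    (stub_bandLimit diagCircle isDiagCircle_diagCircle)
    (stub_actionLipschitz diagCircle isDiagCircle_diagCircle)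
    (stub_eulerWord diagCircle isDiagCircle_diagCircle)
    stub_circleEngine.1 stub_circleEngine.2 stub_torusSmallBalls
    (stub_haarSmallBalls diagCircle isDiagCircle_diagCircle)
    (stub_circleUntilt diagCircle isDiagCircle_diagCircle)

/-! ## §6 Checks against the landed Negative lemmas and `Disproof.lean` (documentation; sorry-free)

* `Negative/MasslessKernel` (`det_wilsonDirac_massless_eq_zero_iff`, = Disproof `kerWilsonDiracMassless_holds`):
  `F ≡ 0` two-star fibres exist at `m = 0`; no stub asserts `F > 0` anywhere — `FibreSmallBalls` /
  `HaarRelativeSmallBalls` are guarded by `0 < F W₀`, `TorusSmallBalls` by `0 < q θ₀`, clause (b′) by `0 < M`.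
* `Negative/TwoWellFloor` (`small_ball_floor`; Disproof §3 `twinWell_refutes_smallBallClause`): a β-UNIFORM
  small-ball clause is refutable; every density statement here carries `(1+β)^p`, and (R1) is a `β = 0` statement.
* `Negative/FreeStarFibre` + Disproof §7.2 (`not_tiltedFlatnessNoLossA`): clause (a) needs a loss; the trunk outputs
  `p = max(p₀/c, p₀) ≥ p₀ > 0`.
* Disproof §9 (`not_tiltedFlatnessUniformInNf`): constants depend on `N_f` through `D = 8N_f`.
* No `_false_without_` theorem exists for item 14070 (Disproof.lean, cdisprove cycle 1 on 14070: "NO KILL"). -/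

/-- The massless kernel theorem, specialised to the `SU(3)` fundamental representation (why the guards
`0 < F W₀` / `0 < M` are load-bearing and kept in every stub). -/
example {L : ℕ} [NeZero L] (U : GaugeConfig 4 L (Matrix.specialUnitaryGroup (Fin 3) ℂ)) :
    (wilsonDirac (fundamentalRep (Fin 3)) U 0 1).det = 0 ↔
      ∃ ψ : TorusSite 4 L × Fin 3 × Fin 4 → ℂ, ψ ≠ 0 ∧
        ∀ (x : TorusSite 4 L) (μ : Fin 4) (a : Fin 3) (α : Fin 4),
          ∑ b, fundamentalRep (Fin 3) (U (x, μ)) a b * ψ (Site.shift x μ, b, α) = ψ (x, a, α) :=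
  Summit.QuantumFields.QCD.Theorems.TiltedFlatnessNegative.det_wilsonDirac_massless_eq_zero_iff
    (fundamentalRep (Fin 3)) fundamentalRep_mem_unitaryGroup U

end Summit.QuantumFields.QCD.Cruxes.TiltedFlatness.CircleTransport
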